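import Summits.CriticalPhenomena.PercolationContinuityZ3.Theorems.Transplant.FKConnectivityAllQPat3KNetBridge
import HarnessLib

/-!
# Connectivity correlation inequalities for `φ_{w,q}`, every `q > 0` — THEOREM 𝒯₂(𝒦), THE BRIDGE CASE, part 2:
# the inner mark in a slot AT A POLE (row B1 in all sixteen {free, contracted} states; census g39 §3 / census g41)

Proof file (`--supports stmt-CriticalPhenomena-4575`), census lineage (gen 41) of LANE 2's FK sub-programme; builds on p205010 (kernel
theorem, internal audit signed; external expert review pending).  No definitions, no named facts, no sorries; standard axioms.

**`FK.bridge_case_ac`** — `N = BRIDGE(Qac, Qad, Qbc, Qbd, Qcd; a, b)` with at most `n + 1` edges, the inner mark `s` an inner vertex of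
the slot `Qac`, and THEOREM 𝒯₂(𝒦) known below `n + 1` edges (hypothesis `ih`): every `famP11` member is nonnegative at `(a, b, s)` on
every minor `(E, C)` of `N`, for every nonnegative weight.  STEP 1: each of `Qad, Qbc, Qbd, Qcd` with ≥ 2 edges is reduced by
`FK.bridge_oneSided` (`…Pat3KNetBridge`); STEP 2: otherwise they are their virtual edges (`FK.IsKNet.eq_singleton_of_card_le_one`);
STEP 3: a virtual edge outside `E ∪ C` is deleted — a minor of `FK.IsKNet.bridge_erase_*`, fewer edges, `ih`; STEP 4: virtual edges in
`E ∩ C` are doubled away (`FK.mval2C_nonneg_of_sdiff`); STEP 5: the K-STATE LEAF `FK.bridgeB1K_famP11_level_nonneg` (`…Pat3BridgeLeafK`,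
names `![a, b, c, d, s]`, state `(L, K)` read off `(E, C)` by `FK.filter_mem_splits`, piece minor `(E ∩ Qac, C ∩ Qac)` valid by `ih`).
The placements `ad, bc, bd` follow by the symmetries of the bridge, `cd` and `s = c` are `…Pat3KNetCaseCD / …CaseC` (`…Pat3KNetT2`).
[cite: AyyerLinussonRavichandran2025, §7 (p. 22)] [cite: Grimmett2006, §3.9 (pp. 63–64)]
-/

namespace Summit.CriticalPhenomena.PercolationContinuityZ3.Theorems

namespace FK

open SimpleGraph Literature.Probability.LatticeModels Literature.Probability.Percolation
open scoped Classical

variable {V : Type*}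

/-! ### The leaf placement `s` inner to the slot `ac` (row B1 in all K-states) -/

section CaseAC

variable [Fintype V] {n : ℕ}

/-- **BRIDGE CASE, `s` INNER TO THE SLOT `ac`.**  Given the induction hypothesis below `n + 1` edges: every `famP11` member is
nonnegative (every nonnegative weight) at `(a, b, s)` on every minor `(E, C)` of `BRIDGE(Qac, Qad, Qbc, Qbd, Qcd; a, b)` with at most
`n + 1` edges, `s` an inner vertex of `Qac`.  One-sided reductions of `ad, bc, bd, cd`; deleted plain slots by `ih` on
`FK.IsKNet.bridge_erase_*`; doubled plain slots; then the K-state leaf `FK.bridgeB1K_famP11_level_nonneg` with the piece minor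
`(E ∩ Qac, C ∩ Qac)`, valid by `ih`. [cite: AyyerLinussonRavichandran2025, §7 (p. 22)] -/
theorem bridge_case_ac
    (ih : ∀ ⦃N : Finset (Sym2 V)⦄ ⦃x y : V⦄, N.card ≤ n → IsKNet N x y → ∀ E C : Finset (Sym2 V), E ⊆ N → C ⊆ N →
      ∀ s : V, (∃ e ∈ N, s ∈ e) → s ≠ x → s ≠ y → ∀ w : ℕ → ℝ, (∀ k, 0 ≤ w k) → ∀ i : ℕ, 0 ≤ mval2C w E C x y s (famGet famP11 i))
    {Qac Qad Qbc Qbd Qcd : Finset (Sym2 V)} {a b c d s : V}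
    (hac : IsKNet Qac a c) (had : IsKNet Qad a d) (hbc : IsKNet Qbc b c) (hbd : IsKNet Qbd b d) (hcd : IsKNet Qcd c d)
    (hsep : BridgeSep Qac Qad Qbc Qbd Qcd a b c d) (hcard : (Qac ∪ Qad ∪ Qbc ∪ Qbd ∪ Qcd).card ≤ n + 1)
    (hsQ : ∃ e ∈ Qac, s ∈ e) (hsa : s ≠ a) (hsc : s ≠ c)
    {E C : Finset (Sym2 V)} (hE : E ⊆ Qac ∪ Qad ∪ Qbc ∪ Qbd ∪ Qcd) (hC : C ⊆ Qac ∪ Qad ∪ Qbc ∪ Qbd ∪ Qcd)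
    (w : ℕ → ℝ) (hw : ∀ k, 0 ≤ w k) (i : ℕ) : 0 ≤ mval2C w E C a b s (famGet famP11 i) := by
  -- distinctness of the skeleton vertices and the mark
  have hab : a ≠ b := fun h => hbc.ne (hsep.v_ac_bc b (h ▸ hac.left_mem) hbc.left_mem)
  have hsb : s ≠ b := fun h => hbc.ne (hsep.v_ac_bc b (h ▸ hsQ) hbc.left_mem)
  have hsd : s ≠ d := fun h => had.ne (hsep.v_ac_ad d (h ▸ hsQ) had.right_mem).symm
  have hceq := hsep.card_eq
  have c1 := hac.card_pos; have c2 := had.card_pos; have c3 := hbc.card_pos; have c4 := hbd.card_pos; have c5 := hcd.card_pos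
  -- the mark is off the interiors of the other four slots
  have hs_ad : (∃ e ∈ Qad, s ∈ e) → s = a ∨ s = d := fun h => Or.inl (hsep.v_ac_ad s hsQ h)
  have hs_bc : (∃ e ∈ Qbc, s ∈ e) → s = b ∨ s = c := fun h => Or.inr (hsep.v_ac_bc s hsQ h)
  have hs_bd : (∃ e ∈ Qbd, s ∈ e) → s = b ∨ s = d := fun h => (hsep.v_ac_bd s hsQ h).elim
  have hs_cd : (∃ e ∈ Qcd, s ∈ e) → s = c ∨ s = d := fun h => Or.inl (hsep.v_ac_cd s hsQ h)
  -- STEP 1: one-sided reduction of every other slot with at least two edges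
  by_cases h2 : 2 ≤ Qad.card
  · have eN : Qac ∪ Qad ∪ Qbc ∪ Qbd ∪ Qcd = (Qac ∪ Qbc ∪ Qbd ∪ Qcd) ∪ Qad := by
      ac_rfl
    have eN' : (Qac ∪ Qbc ∪ Qbd ∪ Qcd) ∪ {s(a, d)} = Qac ∪ {s(a, d)} ∪ Qbc ∪ Qbd ∪ Qcd := by
      ac_rfl
    have hR : (Qac ∪ Qbc ∪ Qbd ∪ Qcd).card + 1 ≤ n := by
      have := Finset.card_union_le (Qac ∪ Qbc ∪ Qbd) Qcd; have := Finset.card_union_le (Qac ∪ Qbc) Qbd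
      have := Finset.card_union_le Qac Qbc; omega
    have hN' : IsKNet ((Qac ∪ Qbc ∪ Qbd ∪ Qcd) ∪ {s(a, d)}) a b := by
      rw [eN']; exact IsKNet.bridge_shrink_ad hac had hbc hbd hcd hsep
    rw [eN] at hE hC
    refine mval2C_nonneg_of_lev2C (fun μ => bridge_oneSided ih (R := Qac ∪ Qbc ∪ Qbd ∪ Qcd) (Q := Qad) ?_ ?_ had ?_
      hN' hR (fun _ => Or.inl rfl) (fun h => Or.inr (hsep.v_ad_bd b h hbd.left_mem)) hs_ad ?_ hsa hsb hE hC i μ) hw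
    · exact Finset.disjoint_union_left.2 ⟨Finset.disjoint_union_left.2 ⟨Finset.disjoint_union_left.2
        ⟨hsep.d_ac_ad, hsep.d_ad_bc.symm⟩, hsep.d_ad_bd.symm⟩, hsep.d_ad_cd.symm⟩
    · intro z hz hzQ
      obtain ⟨e, he, hze⟩ := hz
      simp only [Finset.mem_union] at he
      rcases he with ((he | he) | he) | he
      · exact Or.inl (hsep.v_ac_ad z ⟨e, he, hze⟩ hzQ)
      · exact (hsep.v_ad_bc z hzQ ⟨e, he, hze⟩).elim
      · exact Or.inr (hsep.v_ad_bd z hzQ ⟨e, he, hze⟩)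
      · exact Or.inr (hsep.v_ad_cd z hzQ ⟨e, he, hze⟩)
    · intro h
      simp only [Finset.mem_union] at h
      rcases h with ((h | h) | h) | h
      · exact had.ne (hsep.v_ac_ad d ⟨_, h, Sym2.mem_mk_right _ _⟩ had.right_mem).symm
      · exact hsep.v_ad_bc a had.left_mem ⟨_, h, Sym2.mem_mk_left _ _⟩
      · exact had.ne (hsep.v_ad_bd a had.left_mem ⟨_, h, Sym2.mem_mk_left _ _⟩)
      · exact had.ne (hsep.v_ad_cd a had.left_mem ⟨_, h, Sym2.mem_mk_left _ _⟩)
    · obtain ⟨e, he, hse⟩ := hsQ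
      exact ⟨e, by simp only [Finset.mem_union]; exact Or.inl (Or.inl (Or.inl he)), hse⟩
  by_cases h3 : 2 ≤ Qbc.card
  · have eN : Qac ∪ Qad ∪ Qbc ∪ Qbd ∪ Qcd = (Qac ∪ Qad ∪ Qbd ∪ Qcd) ∪ Qbc := by
      ac_rfl
    have eN' : (Qac ∪ Qad ∪ Qbd ∪ Qcd) ∪ {s(b, c)} = Qac ∪ Qad ∪ {s(b, c)} ∪ Qbd ∪ Qcd := by
      ac_rfl
    have hR : (Qac ∪ Qad ∪ Qbd ∪ Qcd).card + 1 ≤ n := by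
      have := Finset.card_union_le (Qac ∪ Qad ∪ Qbd) Qcd; have := Finset.card_union_le (Qac ∪ Qad) Qbd
      have := Finset.card_union_le Qac Qad; omega
    have hN' : IsKNet ((Qac ∪ Qad ∪ Qbd ∪ Qcd) ∪ {s(b, c)}) a b := by
      rw [eN']; exact IsKNet.bridge_shrink_bc hac had hbc hbd hcd hsep
    rw [eN] at hE hC
    refine mval2C_nonneg_of_lev2C (fun μ => bridge_oneSided ih (R := Qac ∪ Qad ∪ Qbd ∪ Qcd) (Q := Qbc) ?_ ?_ hbc ?_
      hN' hR (fun h => Or.inr (hsep.v_ac_bc a hac.left_mem h)) (fun _ => Or.inl rfl) hs_bc ?_ hsa hsb hE hC i μ) hw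
    · exact Finset.disjoint_union_left.2 ⟨Finset.disjoint_union_left.2 ⟨Finset.disjoint_union_left.2
        ⟨hsep.d_ac_bc, hsep.d_ad_bc⟩, hsep.d_bc_bd.symm⟩, hsep.d_bc_cd.symm⟩
    · intro z hz hzQ
      obtain ⟨e, he, hze⟩ := hz
      simp only [Finset.mem_union] at he
      rcases he with ((he | he) | he) | he
      · exact Or.inr (hsep.v_ac_bc z ⟨e, he, hze⟩ hzQ)
      · exact (hsep.v_ad_bc z ⟨e, he, hze⟩ hzQ).elim
      · exact Or.inl (hsep.v_bc_bd z hzQ ⟨e, he, hze⟩)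
      · exact Or.inr (hsep.v_bc_cd z hzQ ⟨e, he, hze⟩)
    · intro h
      simp only [Finset.mem_union] at h
      rcases h with ((h | h) | h) | h
      · exact hbc.ne (hsep.v_ac_bc b ⟨_, h, Sym2.mem_mk_left _ _⟩ hbc.left_mem)
      · exact hsep.v_ad_bc b ⟨_, h, Sym2.mem_mk_left _ _⟩ hbc.left_mem
      · exact hbc.ne (hsep.v_bc_bd c hbc.right_mem ⟨_, h, Sym2.mem_mk_right _ _⟩).symm
      · exact hbc.ne (hsep.v_bc_cd b hbc.left_mem ⟨_, h, Sym2.mem_mk_left _ _⟩)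
    · obtain ⟨e, he, hse⟩ := hsQ
      exact ⟨e, by simp only [Finset.mem_union]; exact Or.inl (Or.inl (Or.inl he)), hse⟩
  by_cases h4 : 2 ≤ Qbd.card
  · have eN : Qac ∪ Qad ∪ Qbc ∪ Qbd ∪ Qcd = (Qac ∪ Qad ∪ Qbc ∪ Qcd) ∪ Qbd := by
      ac_rfl
    have eN' : (Qac ∪ Qad ∪ Qbc ∪ Qcd) ∪ {s(b, d)} = Qac ∪ Qad ∪ Qbc ∪ {s(b, d)} ∪ Qcd := by
      ac_rfl
    have hR : (Qac ∪ Qad ∪ Qbc ∪ Qcd).card + 1 ≤ n := by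
      have := Finset.card_union_le (Qac ∪ Qad ∪ Qbc) Qcd; have := Finset.card_union_le (Qac ∪ Qad) Qbc
      have := Finset.card_union_le Qac Qad; omega
    have hN' : IsKNet ((Qac ∪ Qad ∪ Qbc ∪ Qcd) ∪ {s(b, d)}) a b := by
      rw [eN']; exact IsKNet.bridge_shrink_bd hac had hbc hbd hcd hsep
    rw [eN] at hE hC
    refine mval2C_nonneg_of_lev2C (fun μ => bridge_oneSided ih (R := Qac ∪ Qad ∪ Qbc ∪ Qcd) (Q := Qbd) ?_ ?_ hbd ?_
      hN' hR (fun h => (hsep.v_ac_bd a hac.left_mem h).elim) (fun _ => Or.inl rfl) hs_bd ?_ hsa hsb hE hC i μ) hw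
    · exact Finset.disjoint_union_left.2 ⟨Finset.disjoint_union_left.2 ⟨Finset.disjoint_union_left.2
        ⟨hsep.d_ac_bd, hsep.d_ad_bd⟩, hsep.d_bc_bd⟩, hsep.d_bd_cd.symm⟩
    · intro z hz hzQ
      obtain ⟨e, he, hze⟩ := hz
      simp only [Finset.mem_union] at he
      rcases he with ((he | he) | he) | he
      · exact (hsep.v_ac_bd z ⟨e, he, hze⟩ hzQ).elim
      · exact Or.inr (hsep.v_ad_bd z ⟨e, he, hze⟩ hzQ)
      · exact Or.inl (hsep.v_bc_bd z ⟨e, he, hze⟩ hzQ)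
      · exact Or.inr (hsep.v_bd_cd z hzQ ⟨e, he, hze⟩)
    · intro h
      simp only [Finset.mem_union] at h
      rcases h with ((h | h) | h) | h
      · exact hsep.v_ac_bd b ⟨_, h, Sym2.mem_mk_left _ _⟩ hbd.left_mem
      · exact hbd.ne (hsep.v_ad_bd b ⟨_, h, Sym2.mem_mk_left _ _⟩ hbd.left_mem)
      · exact hbd.ne (hsep.v_bc_bd d ⟨_, h, Sym2.mem_mk_right _ _⟩ hbd.right_mem).symm
      · exact hbd.ne (hsep.v_bd_cd b hbd.left_mem ⟨_, h, Sym2.mem_mk_left _ _⟩)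
    · obtain ⟨e, he, hse⟩ := hsQ
      exact ⟨e, by simp only [Finset.mem_union]; exact Or.inl (Or.inl (Or.inl he)), hse⟩
  by_cases h5 : 2 ≤ Qcd.card
  · have hR : (Qac ∪ Qad ∪ Qbc ∪ Qbd).card + 1 ≤ n := by
      have := Finset.card_union_le (Qac ∪ Qad ∪ Qbc) Qbd; have := Finset.card_union_le (Qac ∪ Qad) Qbc
      have := Finset.card_union_le Qac Qad; omega
    refine mval2C_nonneg_of_lev2C (fun μ => bridge_oneSided ih (R := Qac ∪ Qad ∪ Qbc ∪ Qbd) (Q := Qcd) ?_ ?_ hcd ?_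
      (IsKNet.bridge_shrink_cd hac had hbc hbd hcd hsep) hR (fun h => Or.inl (hsep.v_ac_cd a hac.left_mem h))
      (fun h => Or.inl (hsep.v_bc_cd b hbc.left_mem h)) hs_cd ?_ hsa hsb hE hC i μ) hw
    · exact Finset.disjoint_union_left.2 ⟨Finset.disjoint_union_left.2 ⟨Finset.disjoint_union_left.2
        ⟨hsep.d_ac_cd, hsep.d_ad_cd⟩, hsep.d_bc_cd⟩, hsep.d_bd_cd⟩
    · intro z hz hzQ
      obtain ⟨e, he, hze⟩ := hz
      simp only [Finset.mem_union] at he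
      rcases he with ((he | he) | he) | he
      · exact Or.inl (hsep.v_ac_cd z ⟨e, he, hze⟩ hzQ)
      · exact Or.inr (hsep.v_ad_cd z ⟨e, he, hze⟩ hzQ)
      · exact Or.inl (hsep.v_bc_cd z ⟨e, he, hze⟩ hzQ)
      · exact Or.inr (hsep.v_bd_cd z ⟨e, he, hze⟩ hzQ)
    · intro h
      simp only [Finset.mem_union] at h
      rcases h with ((h | h) | h) | h
      · exact hcd.ne (hsep.v_ac_cd d ⟨_, h, Sym2.mem_mk_right _ _⟩ hcd.right_mem).symm
      · exact hcd.ne (hsep.v_ad_cd c ⟨_, h, Sym2.mem_mk_left _ _⟩ hcd.left_mem)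
      · exact hcd.ne (hsep.v_bc_cd d ⟨_, h, Sym2.mem_mk_right _ _⟩ hcd.right_mem).symm
      · exact hcd.ne (hsep.v_bd_cd c ⟨_, h, Sym2.mem_mk_left _ _⟩ hcd.left_mem)
    · obtain ⟨e, he, hse⟩ := hsQ
      exact ⟨e, by simp only [Finset.mem_union]; exact Or.inl (Or.inl (Or.inl he)), hse⟩
  -- STEP 2: every other slot is its virtual edge
  obtain rfl : Qad = {s(a, d)} := had.eq_singleton_of_card_le_one (by omega)
  obtain rfl : Qbc = {s(b, c)} := hbc.eq_singleton_of_card_le_one (by omega)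
  obtain rfl : Qbd = {s(b, d)} := hbd.eq_singleton_of_card_le_one (by omega)
  obtain rfl : Qcd = {s(c, d)} := hcd.eq_singleton_of_card_le_one (by omega)
  simp only [Finset.card_singleton] at hceq
  have hsN : ∀ {M : Finset (Sym2 V)}, Qac ⊆ M → ∃ e ∈ M, s ∈ e := fun hM => by
    obtain ⟨e, he, hse⟩ := hsQ; exact ⟨e, hM he, hse⟩
  -- STEP 3: a plain slot outside `E ∪ C` is deleted (a minor of the bridge minus that slot)
  by_cases x_ad : s(a, d) ∈ E ∨ s(a, d) ∈ C
  swap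
  · have hM := IsKNet.bridge_erase_ad hac hbc hbd hcd hsep
    have hNM : Qac ∪ {s(a, d)} ∪ {s(b, c)} ∪ {s(b, d)} ∪ {s(c, d)} ⊆ insert s(a, d) (Qac ∪ {s(b, c)} ∪ {s(b, d)} ∪ {s(c, d)}) :=
      (show Qac ∪ {s(a, d)} ∪ {s(b, c)} ∪ {s(b, d)} ∪ {s(c, d)} = insert s(a, d) (Qac ∪ {s(b, c)} ∪ {s(b, d)} ∪ {s(c, d)}) by rw [Finset.insert_eq]; ac_rfl).le
    have hcM : (Qac ∪ {s(b, c)} ∪ {s(b, d)} ∪ {s(c, d)}).card ≤ n := by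
      have := Finset.card_union_le (Qac ∪ {s(b, c)} ∪ {s(b, d)}) {s(c, d)}
      have := Finset.card_union_le (Qac ∪ {s(b, c)}) {s(b, d)}; have := Finset.card_union_le Qac {s(b, c)}
      simp only [Finset.card_singleton] at *; omega
    exact ih hcM hM E C ((Finset.subset_insert_iff_of_notMem fun h => x_ad (Or.inl h)).1 (hE.trans hNM))
      ((Finset.subset_insert_iff_of_notMem fun h => x_ad (Or.inr h)).1 (hC.trans hNM))
      s (hsN (by intro e he; simp only [Finset.mem_union]; exact Or.inl (Or.inl (Or.inl he)))) hsa hsb w hw i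
  by_cases x_bc : s(b, c) ∈ E ∨ s(b, c) ∈ C
  swap
  · have hM := IsKNet.bridge_erase_bc hac had hbd hcd hsep
    have hNM : Qac ∪ {s(a, d)} ∪ {s(b, c)} ∪ {s(b, d)} ∪ {s(c, d)} ⊆ insert s(b, c) (Qac ∪ {s(a, d)} ∪ {s(b, d)} ∪ {s(c, d)}) :=
      (show Qac ∪ {s(a, d)} ∪ {s(b, c)} ∪ {s(b, d)} ∪ {s(c, d)} = insert s(b, c) (Qac ∪ {s(a, d)} ∪ {s(b, d)} ∪ {s(c, d)}) by rw [Finset.insert_eq]; ac_rfl).le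
    have hcM : (Qac ∪ {s(a, d)} ∪ {s(b, d)} ∪ {s(c, d)}).card ≤ n := by
      have := Finset.card_union_le (Qac ∪ {s(a, d)} ∪ {s(b, d)}) {s(c, d)}
      have := Finset.card_union_le (Qac ∪ {s(a, d)}) {s(b, d)}; have := Finset.card_union_le Qac {s(a, d)}
      simp only [Finset.card_singleton] at *; omega
    exact ih hcM hM E C ((Finset.subset_insert_iff_of_notMem fun h => x_bc (Or.inl h)).1 (hE.trans hNM))
      ((Finset.subset_insert_iff_of_notMem fun h => x_bc (Or.inr h)).1 (hC.trans hNM))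
      s (hsN (by intro e he; simp only [Finset.mem_union]; exact Or.inl (Or.inl (Or.inl he)))) hsa hsb w hw i
  by_cases x_bd : s(b, d) ∈ E ∨ s(b, d) ∈ C
  swap
  · have hM := IsKNet.bridge_erase_bd hac had hbc hcd hsep
    have hNM : Qac ∪ {s(a, d)} ∪ {s(b, c)} ∪ {s(b, d)} ∪ {s(c, d)} ⊆ insert s(b, d) (Qac ∪ {s(a, d)} ∪ {s(b, c)} ∪ {s(c, d)}) :=
      (show Qac ∪ {s(a, d)} ∪ {s(b, c)} ∪ {s(b, d)} ∪ {s(c, d)} = insert s(b, d) (Qac ∪ {s(a, d)} ∪ {s(b, c)} ∪ {s(c, d)}) by rw [Finset.insert_eq]; ac_rfl).le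
    have hcM : (Qac ∪ {s(a, d)} ∪ {s(b, c)} ∪ {s(c, d)}).card ≤ n := by
      have := Finset.card_union_le (Qac ∪ {s(a, d)} ∪ {s(b, c)}) {s(c, d)}
      have := Finset.card_union_le (Qac ∪ {s(a, d)}) {s(b, c)}; have := Finset.card_union_le Qac {s(a, d)}
      simp only [Finset.card_singleton] at *; omega
    exact ih hcM hM E C ((Finset.subset_insert_iff_of_notMem fun h => x_bd (Or.inl h)).1 (hE.trans hNM))
      ((Finset.subset_insert_iff_of_notMem fun h => x_bd (Or.inr h)).1 (hC.trans hNM))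
      s (hsN (by intro e he; simp only [Finset.mem_union]; exact Or.inl (Or.inl (Or.inl he)))) hsa hsb w hw i
  by_cases x_cd : s(c, d) ∈ E ∨ s(c, d) ∈ C
  swap
  · have hM := IsKNet.bridge_erase_cd hac had hbc hbd hsep
    have hNM : Qac ∪ {s(a, d)} ∪ {s(b, c)} ∪ {s(b, d)} ∪ {s(c, d)} ⊆ insert s(c, d) (Qac ∪ {s(a, d)} ∪ {s(b, c)} ∪ {s(b, d)}) :=
      (show Qac ∪ {s(a, d)} ∪ {s(b, c)} ∪ {s(b, d)} ∪ {s(c, d)} = insert s(c, d) (Qac ∪ {s(a, d)} ∪ {s(b, c)} ∪ {s(b, d)}) by rw [Finset.insert_eq]; ac_rfl).le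
    have hcM : (Qac ∪ {s(a, d)} ∪ {s(b, c)} ∪ {s(b, d)}).card ≤ n := by
      have := Finset.card_union_le (Qac ∪ {s(a, d)} ∪ {s(b, c)}) {s(b, d)}
      have := Finset.card_union_le (Qac ∪ {s(a, d)}) {s(b, c)}; have := Finset.card_union_le Qac {s(a, d)}
      simp only [Finset.card_singleton] at *; omega
    exact ih hcM hM E C ((Finset.subset_insert_iff_of_notMem fun h => x_cd (Or.inl h)).1 (hE.trans hNM))
      ((Finset.subset_insert_iff_of_notMem fun h => x_cd (Or.inr h)).1 (hC.trans hNM))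
      s (hsN (by intro e he; simp only [Finset.mem_union]; exact Or.inl (Or.inl (Or.inl he)))) hsa hsb w hw i
  -- STEP 4: plain slots of `E ∩ C` are doubled away
  set P4 : Finset (Sym2 V) := {s(a, d), s(b, c), s(b, d), s(c, d)} with hP4
  have hNP : ∀ e ∈ Qac ∪ {s(a, d)} ∪ {s(b, c)} ∪ {s(b, d)} ∪ {s(c, d)}, e ∉ Qac → e ∈ P4 := by
    intro e he hq
    simp only [Finset.mem_union, Finset.mem_singleton] at he
    simp only [hP4, Finset.mem_insert, Finset.mem_singleton]
    rcases he with (((h | h) | h) | h) | h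
    exacts [absurd h hq, Or.inl h, Or.inr (Or.inl h), Or.inr (Or.inr (Or.inl h)), Or.inr (Or.inr (Or.inr h))]
  have hPEC : ∀ e ∈ P4, e ∈ E ∨ e ∈ C := by
    intro e he
    simp only [hP4, Finset.mem_insert, Finset.mem_singleton] at he
    rcases he with rfl | rfl | rfl | rfl
    exacts [x_ad, x_bc, x_bd, x_cd]
  have hPQ : ∀ e ∈ P4, e ∉ Qac := by
    intro e he
    simp only [hP4, Finset.mem_insert, Finset.mem_singleton] at he
    rcases he with rfl | rfl | rfl | rfl
    exacts [Finset.disjoint_singleton_right.1 hsep.d_ac_ad, Finset.disjoint_singleton_right.1 hsep.d_ac_bc,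
      Finset.disjoint_singleton_right.1 hsep.d_ac_bd, Finset.disjoint_singleton_right.1 hsep.d_ac_cd]
  refine mval2C_nonneg_of_sdiff w (D := C ∩ P4) Finset.inter_subset_left a b s _ ?_
  set E' : Finset (Sym2 V) := E \ (C ∩ P4) with hE'
  -- STEP 5: the K-state leaf B1
  set p : Fin 5 → V := ![a, b, c, d, s] with hp
  have hinj : Function.Injective p := injective_vec5 hab hac.ne had.ne hbc.ne hbd.ne hcd.ne hsa hsb hsc hsd
  have hPS : plainSet p skelB1 = P4 := by
    ext e
    rw [mem_plainSet_iff]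
    simp only [skelB1, List.mem_cons, List.not_mem_nil, or_false, hP4, Finset.mem_insert, Finset.mem_singleton, pedge]
    constructor
    · rintro ⟨e₀, he₀, rfl⟩
      rcases he₀ with rfl | rfl | rfl | rfl <;> simp [hp]
    · rintro (rfl | rfl | rfl | rfl)
      exacts [⟨(0, 3), Or.inl rfl, rfl⟩, ⟨(1, 2), Or.inr (Or.inl rfl), rfl⟩, ⟨(1, 3), Or.inr (Or.inr (Or.inl rfl)), rfl⟩,
        ⟨(2, 3), Or.inr (Or.inr (Or.inr rfl)), rfl⟩]
  have hLK : (skelB1.filter (fun e => decide (pedge p e ∈ E')), skelB1.filter (fun e => decide (pedge p e ∈ C))) ∈ splits skelB1 := by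
    refine filter_mem_splits skelB1 _ _ fun e₀ he₀ => ?_
    have hP : pedge p e₀ ∈ P4 := by rw [← hPS]; exact (mem_plainSet_iff p skelB1 _).2 ⟨e₀, he₀, rfl⟩
    by_cases hc : pedge p e₀ ∈ C
    · have hn : pedge p e₀ ∉ E' := fun h => (Finset.mem_sdiff.1 h).2 (Finset.mem_inter.2 ⟨hc, hP⟩)
      simp [hc, hn]
    · have hy : pedge p e₀ ∈ E' := Finset.mem_sdiff.2 ⟨(hPEC _ hP).resolve_right hc, fun h => hc (Finset.mem_inter.1 h).1⟩
      simp [hc, hy]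
  have hbQ : b ∉ {z : V | ∃ e ∈ Qac, z ∈ e} := fun h => hbc.ne (hsep.v_ac_bc b h hbc.left_mem)
  have hdQ : d ∉ {z : V | ∃ e ∈ Qac, z ∈ e} := fun h => had.ne (hsep.v_ac_ad d h had.right_mem).symm
  have hp5 : ∀ j, p j ∈ {z : V | ∃ e ∈ Qac, z ∈ e} → p j = p 0 ∨ p j = p 2 ∨ p j = p 4 := by
    intro j hj
    fin_cases j
    · exact Or.inl rfl
    · exact absurd hj hbQ
    · exact Or.inr (Or.inl rfl)
    · exact absurd hj hdQ
    · exact Or.inr (Or.inr rfl)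
  have hdisj : Disjoint (plainSet p skelB1) (E' ∩ Qac) := by
    rw [hPS]
    exact Finset.disjoint_left.2 fun e he h => hPQ e he (Finset.mem_inter.1 h).2
  have hval : ∀ n' ν, 0 ≤ lev2C (E' ∩ Qac) (C ∩ Qac) (p 0) (p 2) (p 4) (famGet famP11 n') ν := fun n' ν =>
    lev2C_nonneg_of_mval2C (fun w' hw' => ih (by omega) hac _ _ Finset.inter_subset_right Finset.inter_subset_right
      s hsQ hsa hsc w' hw' n') ν
  have hleaf := fun n' ν => bridgeB1K_famP11_level_nonneg hinj hLK (EQ := E' ∩ Qac) (CQ := C ∩ Qac)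
    (VQ := {z : V | ∃ e ∈ Qac, z ∈ e})
    (span_sub_of_subset (fun e he z hz => ⟨e, Finset.mem_coe.1 he, hz⟩) Finset.inter_subset_right Finset.inter_subset_right)
    hsQ hp5 hdisj hval n' ν
  -- reading the leaf back on `(E', C)`
  have hE'N : E' ⊆ Qac ∪ {s(a, d)} ∪ {s(b, c)} ∪ {s(b, d)} ∪ {s(c, d)} := Finset.sdiff_subset.trans hE
  have hEeq : plainSet p (skelB1.filter fun e => decide (pedge p e ∈ E')) ∪ E' ∩ Qac = E' := by
    ext e
    rw [Finset.mem_union, mem_plainSet_filter, Finset.mem_inter]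
    constructor
    · rintro (⟨e₀, _, hf, rfl⟩ | ⟨h, _⟩)
      · exact of_decide_eq_true hf
      · exact h
    · intro h
      by_cases hq : e ∈ Qac
      · exact Or.inr ⟨h, hq⟩
      · have hP : e ∈ plainSet p skelB1 := by rw [hPS]; exact hNP e (hE'N h) hq
        obtain ⟨e₀, he₀, rfl⟩ := (mem_plainSet_iff p skelB1 e).1 hP
        exact Or.inl ⟨e₀, he₀, decide_eq_true h, rfl⟩
  have hCeq : plainSet p (skelB1.filter fun e => decide (pedge p e ∈ C)) ∪ C ∩ Qac = C := by
    ext e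
    rw [Finset.mem_union, mem_plainSet_filter, Finset.mem_inter]
    constructor
    · rintro (⟨e₀, _, hf, rfl⟩ | ⟨h, _⟩)
      · exact of_decide_eq_true hf
      · exact h
    · intro h
      by_cases hq : e ∈ Qac
      · exact Or.inr ⟨h, hq⟩
      · have hP : e ∈ plainSet p skelB1 := by rw [hPS]; exact hNP e (hC h) hq
        obtain ⟨e₀, he₀, rfl⟩ := (mem_plainSet_iff p skelB1 e).1 hP
        exact Or.inl ⟨e₀, he₀, decide_eq_true h, rfl⟩
  refine mval2C_nonneg_of_lev2C (fun μ => ?_) hw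
  have h := hleaf i μ
  rw [hEeq, hCeq] at h
  exact h

end CaseAC

end FK

end Summit.CriticalPhenomena.PercolationContinuityZ3.Theorems
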